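import Summits.AtomisticToContinuum.FouriersLaw.Theses.VanishingNoiseTransfer
import Literature.MathematicalPhysics.KineticTheory.VelocityFlipNoise
import Summits.AtomisticToContinuum.FouriersLaw.Theorems.VanishingNoiseTransferNoiseLocalityStubFlipSteadyStateWellPosed
import Summits.AtomisticToContinuum.FouriersLaw.Theorems.VanishingNoiseTransferNoiseLocalityStubPositiveNoisyConductance
import Summits.AtomisticToContinuum.FouriersLaw.Theorems.VanishingNoiseTransferNoiseLocalityStubResponseContinuousInNoise
import Summits.AtomisticToContinuum.FouriersLaw.Theorems.VanishingNoiseTransferNoiseLocalityFeketeReductionAux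

/-!
# `NoiseLocality` (stmt-AtomisticToContinuum-11975) reduced to two fixed-`N` sign conditions (monotone reduction)

`--supports stmt-AtomisticToContinuum-11975` record of line `fekete-transposed-uniformity`, skeleton v6 (lead
`prover-line-stmt-AtomisticToContinuum-11975-c2-0`, 2026-08-17; tree copy `Cruxes/NoiseLocality/Lines/fekete_transposed_uniformity.lean`).
The crux `VanishingNoiseTransfer.NoiseLocality` asks for ONE modulus `w → 0` at `0⁺`, uniform in the length `N`, with
`|1/D_N(ε) − 1/D_N(0)| ≤ w(ε)` (division-free form).  v5 of the line (lead c1, `…FeketeReduction{Aux,,V5}`) reduced it to the uniform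
two-sided series law (an `N`-uniform statement containing the open sibling cruxes stmt-14041 ∧ stmt-11748).  This file records the
v6 observation that NO `N`-uniform constant is needed:

* `modulus_of_monotone` — pure real analysis: if `r N` (`N ≥ 2`) is continuous on `[0,1]`, NONINCREASING IN `N` at each
  `ε ∈ (0,1]`, `r N 0 ≤ r N ε` on `(0,1]`, and `0 ≤ r N 0`, then `w ε := sup_N (r N ε − r N 0) → 0` at `0⁺` (given `η`, take `N₀`
  with `r N₀ 0 < inf_N r N 0 + η/4`; continuity of `r 2, …, r N₀` at `0`; for `N > N₀`, `r N ε ≤ r N₀ ε < inf + η/2 ≤ r N 0 + η/2`).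
* `canonical_of_three` — the LANDED fixed-`N` stubs 1–3 of the line (`…Theorems.NoiseLocality.stub_flipSteadyStateWellPosed` p133081,
  `…stub_responseContinuousInNoise` p134029, `…stub_positiveNoisyConductance` p133179) give canonical unique flip-steady families and
  canonical responses `Dc N : ℝ → ℝ`, continuous on `[0,1]`, positive for `N ≥ 2`, identified with every unique family's response.
* `noiseLocality_of_monotone` — **(M1) → (M2) → NoiseLocality**, where (M1) `D_N(ε) ≤ D_{N+1}(ε)` (`N ≥ 2`, `ε ∈ (0,1]`: the
  response is nondecreasing in the length at every positive flip rate) and (M2) `D_N(ε) ≤ D_N(0)` (`N ≥ 2`, `ε ∈ (0,1]`: flips never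
  increase the finite-`N` response) are the two registered stubs `stub_responseMonotoneInLength` / `stub_flipsReduceResponse` of
  the v6 skeleton, spelled out verbatim as hypotheses.  CONDITIONAL (both stubs open); nothing here closes the item.
* `helper_noiseLocalityOfMonotone` — the same implication in one-line registry form.

No `sorry`, no definitions, no named facts; axioms `propext`, `Classical.choice`, `Quot.sound`.
-/

noncomputable section

namespace Summit.AtomisticToContinuum.FouriersLaw.Theorems.NoiseLocality.MonotoneReduction

open Filter Topology MeasureTheory
open Literature.MathematicalPhysics.KineticTheory.HeatConduction

/-! ## The transfer: monotone in the length + noise sign + fixed-`N` continuity ⇒ ONE modulus -/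

/-- **`modulus_of_monotone`.** If `r N : ℝ → ℝ` (`N ≥ 2`) is continuous on `[0,1]`, nonincreasing in `N` at every
`ε ∈ (0,1]`, satisfies `r N 0 ≤ r N ε` for `ε ∈ (0,1]`, and `0 ≤ r N 0`, then there is ONE modulus `w → 0` at `0⁺` with
`|r N ε − r N 0| ≤ w ε` for all `N ≥ 2`, `ε ∈ (0,1]`.  Proof: `w ε := sup_N (r N ε − r N 0)` (bounded by `r 2 ε`); given
`η > 0` pick `N₀` with `r N₀ 0 < inf_N r N 0 + η/4` and use continuity of `r 2, …, r N₀` at `0`; for `N > N₀`,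
`r N ε ≤ r N₀ ε < inf + η/2 ≤ r N 0 + η/2`. [folklore] -/
theorem modulus_of_monotone :
    ∀ (r : ℕ → ℝ → ℝ),
      (∀ N : ℕ, 2 ≤ N → ContinuousOn (r N) (Set.Icc 0 1)) →
      (∀ N : ℕ, 2 ≤ N → ∀ ε : ℝ, 0 < ε → ε ≤ 1 → r (N + 1) ε ≤ r N ε) →
      (∀ N : ℕ, 2 ≤ N → ∀ ε : ℝ, 0 < ε → ε ≤ 1 → r N 0 ≤ r N ε) →
      (∀ N : ℕ, 2 ≤ N → 0 ≤ r N 0) →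
      ∃ w : ℝ → ℝ, Filter.Tendsto w (nhdsWithin 0 (Set.Ioi 0)) (nhds 0) ∧
        ∀ N : ℕ, 2 ≤ N → ∀ ε : ℝ, 0 < ε → ε ≤ 1 → |r N ε - r N 0| ≤ w ε := by
  intro r hcont hmono hnoise hpos
  -- iterated monotonicity in the length
  have hchain : ∀ ε : ℝ, 0 < ε → ε ≤ 1 → ∀ N : ℕ, 2 ≤ N → ∀ M : ℕ, N ≤ M → r M ε ≤ r N ε := by
    intro ε hε hε1 N hN M hNM
    induction M, hNM using Nat.le_induction with
    | base => exact le_rfl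
    | succ M hNM ih => exact (hmono M (hN.trans hNM) ε hε hε1).trans ih
  -- the discrepancy table, indexed from `N = 2`
  set g : ℝ → ℕ → ℝ := fun ε n => r (n + 2) ε - r (n + 2) 0 with hg
  have g_nonneg : ∀ ε : ℝ, 0 < ε → ε ≤ 1 → ∀ n, 0 ≤ g ε n := fun ε hε hε1 n =>
    sub_nonneg.2 (hnoise (n + 2) (by omega) ε hε hε1)
  have g_le : ∀ ε : ℝ, 0 < ε → ε ≤ 1 → ∀ n, g ε n ≤ r 2 ε := by
    intro ε hε hε1 n
    have h1 : r (n + 2) ε ≤ r 2 ε := hchain ε hε hε1 2 le_rfl (n + 2) (by omega)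
    have h2 : 0 ≤ r (n + 2) 0 := hpos (n + 2) (by omega)
    simp only [hg]
    linarith
  have hbdd : ∀ ε : ℝ, 0 < ε → ε ≤ 1 → BddAbove (Set.range (g ε)) := fun ε hε hε1 =>
    ⟨r 2 ε, by rintro _ ⟨n, rfl⟩; exact g_le ε hε hε1 n⟩
  -- transfer of limits from `𝓝[Icc 0 1] 0` to `𝓝[>] 0`
  have to_right : ∀ {f : ℝ → ℝ} {a : ℝ}, Tendsto f (𝓝[Set.Icc (0 : ℝ) 1] 0) (𝓝 a) →
      Tendsto f (𝓝[>] (0 : ℝ)) (𝓝 a) := by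
    intro f a h
    have h' := h.mono_left (nhdsWithin_mono (0 : ℝ) (Set.Ioc_subset_Icc_self (a := (0 : ℝ)) (b := 1)))
    rwa [nhdsWithin_Ioc_eq_nhdsGT zero_lt_one] at h'
  have h0mem : (0 : ℝ) ∈ Set.Icc (0 : ℝ) 1 := ⟨le_rfl, zero_le_one⟩
  refine ⟨fun ε => ⨆ n, g ε n, ?_, ?_⟩
  · -- the modulus tends to `0`
    refine Metric.tendsto_nhds.mpr fun η hη => ?_
    have hbb : BddBelow (Set.range fun n : ℕ => r (n + 2) 0) :=
      ⟨0, by rintro _ ⟨n, rfl⟩; exact hpos (n + 2) (by omega)⟩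
    have hr₀le : ∀ n : ℕ, (⨅ m : ℕ, r (m + 2) 0) ≤ r (n + 2) 0 := fun n => ciInf_le hbb n
    obtain ⟨n₀, hn₀⟩ : ∃ n₀ : ℕ, r (n₀ + 2) 0 < (⨅ m : ℕ, r (m + 2) 0) + η / 4 :=
      exists_lt_of_ciInf_lt (by linarith)
    have hf : ∀ᶠ ε in 𝓝[>] (0 : ℝ), ∀ n ∈ Finset.range (n₀ + 1), r (n + 2) ε < r (n + 2) 0 + η / 4 := by
      refine (eventually_all_finset _).mpr fun n _ => ?_
      have hr : Tendsto (r (n + 2)) (𝓝[>] (0 : ℝ)) (𝓝 (r (n + 2) 0)) :=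
        to_right (hcont (n + 2) (by omega) 0 h0mem)
      exact hr.eventually (gt_mem_nhds (by linarith))
    have h2 : ∀ᶠ ε in 𝓝[>] (0 : ℝ), ε ≤ 1 := mem_nhdsWithin_of_mem_nhds (Iic_mem_nhds one_pos)
    have h3 : ∀ᶠ ε in 𝓝[>] (0 : ℝ), 0 < ε := self_mem_nhdsWithin
    filter_upwards [hf, h2, h3] with ε hfε hε1 hε
    have hall : ∀ n, g ε n ≤ η / 2 := by
      intro n
      rcases le_or_gt n n₀ with hn | hn
      · have := hfε n (Finset.mem_range.mpr (by omega))
        simp only [hg]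
        linarith
      · have a : r (n + 2) ε ≤ r (n₀ + 2) ε := hchain ε hε hε1 (n₀ + 2) (by omega) (n + 2) (by omega)
        have b := hfε n₀ (Finset.mem_range.mpr (by omega))
        have c := hr₀le n
        simp only [hg]
        linarith
    have hsup : (⨆ n, g ε n) ≤ η / 2 := ciSup_le hall
    have hsup0 : 0 ≤ ⨆ n, g ε n := le_ciSup_of_le (hbdd ε hε hε1) 0 (g_nonneg ε hε hε1 0)
    rw [Real.dist_eq, sub_zero, abs_of_nonneg hsup0]
    linarith
  · -- the bound itself
    intro N hN ε hε hε1
    obtain ⟨n, rfl⟩ : ∃ n, N = n + 2 := ⟨N - 2, by omega⟩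
    have e : |r (n + 2) ε - r (n + 2) 0| = g ε n := by
      simp only [hg]
      exact abs_of_nonneg (g_nonneg ε hε hε1 n)
    rw [e]
    exact le_ciSup (hbdd ε hε hε1) n

/-! ## Canonical families and responses from the LANDED stubs 1–3 -/

/-- **Landed stubs 1–3 ⇒ canonical unique flip-steady families `μc N ε` (`ε ∈ [0,1]`) and canonical responses `Dc N : ℝ → ℝ`,
continuous on `[0,1]`, positive for `N ≥ 2`, and equal to the response of EVERY unique flip-steady family at rate `ε`.**
(Steps (0)–(2) of `FeketeReduction.canonical_of_stubs`, without any series law.) [folklore] -/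
theorem canonical_of_three {ω₂ lam β γ : ℝ} (hω : 0 < ω₂) (hl : 0 < lam) (hβ : 0 < β) (hγ : 0 < γ) {T : ℝ}
    (hT : 0 < T) :
    ∃ (μc : (N : ℕ) → ℝ → ℝ → ℝ → Measure (PhaseSpace N)) (Dc : ℕ → ℝ → ℝ),
      (∀ (N : ℕ) (ε : ℝ), 0 ≤ ε → ε ≤ 1 → ∀ T_L T_R : ℝ, 0 < T_L → 0 < T_R →
        (pinnedChain ω₂ lam β γ).IsFlipSteadyState N T_L T_R ε (μc N ε T_L T_R) ∧
          ∀ ν : Measure (PhaseSpace N),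
            (pinnedChain ω₂ lam β γ).IsFlipSteadyState N T_L T_R ε ν → ν = μc N ε T_L T_R) ∧
      (∀ N : ℕ, ContinuousOn (Dc N) (Set.Icc 0 1)) ∧
      (∀ N : ℕ, 2 ≤ N → ∀ ε : ℝ, 0 ≤ ε → ε ≤ 1 → 0 < Dc N ε) ∧
      (∀ (N : ℕ) (ε : ℝ), 0 ≤ ε → ε ≤ 1 →
        ∀ μ : ℝ → ℝ → Measure (PhaseSpace N),
          (∀ T_L T_R : ℝ, 0 < T_L → 0 < T_R →
            (pinnedChain ω₂ lam β γ).IsFlipSteadyState N T_L T_R ε (μ T_L T_R) ∧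
              ∀ ν : Measure (PhaseSpace N),
                (pinnedChain ω₂ lam β γ).IsFlipSteadyState N T_L T_R ε ν → ν = μ T_L T_R) →
          Tendsto (fun δ : ℝ =>
            (pinnedChain ω₂ lam β γ).totalCurrent (μ (T + δ / 2) (T - δ / 2)) / δ) (𝓝[≠] 0)
            (𝓝 (Dc N ε))) := by
  -- (0) the canonical flip-steady family (landed stub 1 + choice; junk outside the box)
  have hex : ∀ (N : ℕ) (ε T_L T_R : ℝ), ∃ μ : Measure (PhaseSpace N),
      (0 ≤ ε → ε ≤ 1 → 0 < T_L → 0 < T_R →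
        (pinnedChain ω₂ lam β γ).IsFlipSteadyState N T_L T_R ε μ ∧
          ∀ ν : Measure (PhaseSpace N),
            (pinnedChain ω₂ lam β γ).IsFlipSteadyState N T_L T_R ε ν → ν = μ) := by
    intro N ε T_L T_R
    by_cases h : 0 ≤ ε ∧ ε ≤ 1 ∧ 0 < T_L ∧ 0 < T_R
    · obtain ⟨μ, hμ⟩ :=
        Summit.AtomisticToContinuum.FouriersLaw.Theorems.NoiseLocality.stub_flipSteadyStateWellPosed
          ω₂ lam β γ hω hl hβ hγ N ε h.1 h.2.1 T_L T_R h.2.2.1 h.2.2.2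
      exact ⟨μ, fun _ _ _ _ => hμ⟩
    · exact ⟨0, fun h0 h1' hL hR => (h ⟨h0, h1', hL, hR⟩).elim⟩
  choose μc hμc using hex
  have hfam : ∀ (N : ℕ) (ε : ℝ), 0 ≤ ε → ε ≤ 1 → ∀ T_L T_R : ℝ, 0 < T_L → 0 < T_R →
      (pinnedChain ω₂ lam β γ).IsFlipSteadyState N T_L T_R ε (μc N ε T_L T_R) ∧
        ∀ ν : Measure (PhaseSpace N),
          (pinnedChain ω₂ lam β γ).IsFlipSteadyState N T_L T_R ε ν → ν = μc N ε T_L T_R :=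
    fun N ε h0 h1' T_L T_R hL hR => hμc N ε T_L T_R h0 h1' hL hR
  -- (1) canonical responses, continuous on `[0,1]` (landed stub 2)
  choose Dc hDc_cont hDc using fun N : ℕ =>
    Summit.AtomisticToContinuum.FouriersLaw.Theorems.NoiseLocality.stub_responseContinuousInNoise
      ω₂ lam β γ hω hl hβ hγ N T hT
  have hDc_can : ∀ (N : ℕ) (ε : ℝ), 0 ≤ ε → ε ≤ 1 →
      Tendsto (fun δ : ℝ => (pinnedChain ω₂ lam β γ).totalCurrent
        (μc N ε (T + δ / 2) (T - δ / 2)) / δ) (𝓝[≠] 0) (𝓝 (Dc N ε)) :=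
    fun N ε h0 h1' => hDc N ε h0 h1' (μc N ε) (hfam N ε h0 h1')
  -- (2) positivity for `N ≥ 2` (landed stub 3)
  have hpos : ∀ N : ℕ, 2 ≤ N → ∀ ε : ℝ, 0 ≤ ε → ε ≤ 1 → 0 < Dc N ε :=
    fun N hN ε h0 h1' =>
      Summit.AtomisticToContinuum.FouriersLaw.Theorems.NoiseLocality.stub_positiveNoisyConductance
        ω₂ lam β γ hω hl hβ hγ N hN ε h0 h1' T hT (μc N ε) (hfam N ε h0 h1') (Dc N ε) (hDc_can N ε h0 h1')
  exact ⟨μc, Dc, hfam, hDc_cont, hpos, hDc⟩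

/-! ## The reduction: (M1) ∧ (M2) ⟹ the crux -/

/-- **`noiseLocality_of_monotone`** — (M1) `stub_responseMonotoneInLength` and (M2) `stub_flipsReduceResponse` of skeleton v6
(their registered texts verbatim as hypotheses) imply `VanishingNoiseTransfer.NoiseLocality`.  `canonical_of_three` gives the canonical
responses; (M1)/(M2) at the canonical families make `r N ε := (Dc N ε)⁻¹` nonincreasing in `N` on `(0,1]` and `≥ r N 0`;
`modulus_of_monotone` yields `w`; the crux's own `μ0, με, D0, Dε` are identified with the canonical ones by uniqueness of limits
along `𝓝[≠] 0` (`N ≥ 2`, weighted form), and `N ≤ 1` is currentless (`FeketeReduction.response_eq_zero_of_le_one`).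
CONDITIONAL: both hypotheses are open stubs. [folklore] -/
theorem noiseLocality_of_monotone
    (hM1 :
    ∀ ω₂ lam β γ : ℝ, 0 < ω₂ → 0 < lam → 0 < β → 0 < γ →
    ∀ (N : ℕ), 2 ≤ N → ∀ ε : ℝ, 0 < ε → ε ≤ 1 → ∀ T : ℝ, 0 < T →
    ∀ μ : ℝ → ℝ →
        MeasureTheory.Measure (Literature.MathematicalPhysics.KineticTheory.HeatConduction.PhaseSpace N),
      (∀ T_L T_R : ℝ, 0 < T_L → 0 < T_R →
        (Literature.MathematicalPhysics.KineticTheory.HeatConduction.pinnedChain ω₂ lam β γ).IsFlipSteadyState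
            N T_L T_R ε (μ T_L T_R) ∧
          ∀ ν : MeasureTheory.Measure (Literature.MathematicalPhysics.KineticTheory.HeatConduction.PhaseSpace N),
            (Literature.MathematicalPhysics.KineticTheory.HeatConduction.pinnedChain ω₂ lam β γ).IsFlipSteadyState
              N T_L T_R ε ν → ν = μ T_L T_R) →
    ∀ μ' : ℝ → ℝ →
        MeasureTheory.Measure (Literature.MathematicalPhysics.KineticTheory.HeatConduction.PhaseSpace (N + 1)),
      (∀ T_L T_R : ℝ, 0 < T_L → 0 < T_R →
        (Literature.MathematicalPhysics.KineticTheory.HeatConduction.pinnedChain ω₂ lam β γ).IsFlipSteadyState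
            (N + 1) T_L T_R ε (μ' T_L T_R) ∧
          ∀ ν : MeasureTheory.Measure (Literature.MathematicalPhysics.KineticTheory.HeatConduction.PhaseSpace (N + 1)),
            (Literature.MathematicalPhysics.KineticTheory.HeatConduction.pinnedChain ω₂ lam β γ).IsFlipSteadyState
              (N + 1) T_L T_R ε ν → ν = μ' T_L T_R) →
    ∀ D D' : ℝ,
      Filter.Tendsto (fun δ : ℝ =>
          (Literature.MathematicalPhysics.KineticTheory.HeatConduction.pinnedChain ω₂ lam β γ).totalCurrent
            (μ (T + δ / 2) (T - δ / 2)) / δ) (nhdsWithin 0 {(0 : ℝ)}ᶜ) (nhds D) →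
      Filter.Tendsto (fun δ : ℝ =>
          (Literature.MathematicalPhysics.KineticTheory.HeatConduction.pinnedChain ω₂ lam β γ).totalCurrent
            (μ' (T + δ / 2) (T - δ / 2)) / δ) (nhdsWithin 0 {(0 : ℝ)}ᶜ) (nhds D') →
      D ≤ D')
    (hM2 :
    ∀ ω₂ lam β γ : ℝ, 0 < ω₂ → 0 < lam → 0 < β → 0 < γ →
    ∀ (N : ℕ), 2 ≤ N → ∀ ε : ℝ, 0 < ε → ε ≤ 1 → ∀ T : ℝ, 0 < T →
    ∀ μ0 : ℝ → ℝ →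
        MeasureTheory.Measure (Literature.MathematicalPhysics.KineticTheory.HeatConduction.PhaseSpace N),
      (∀ T_L T_R : ℝ, 0 < T_L → 0 < T_R →
        (Literature.MathematicalPhysics.KineticTheory.HeatConduction.pinnedChain ω₂ lam β γ).IsSteadyState
            N T_L T_R (μ0 T_L T_R) ∧
          ∀ ν : MeasureTheory.Measure (Literature.MathematicalPhysics.KineticTheory.HeatConduction.PhaseSpace N),
            (Literature.MathematicalPhysics.KineticTheory.HeatConduction.pinnedChain ω₂ lam β γ).IsSteadyState
              N T_L T_R ν → ν = μ0 T_L T_R) →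
    ∀ με : ℝ → ℝ →
        MeasureTheory.Measure (Literature.MathematicalPhysics.KineticTheory.HeatConduction.PhaseSpace N),
      (∀ T_L T_R : ℝ, 0 < T_L → 0 < T_R →
        (Literature.MathematicalPhysics.KineticTheory.HeatConduction.pinnedChain ω₂ lam β γ).IsFlipSteadyState
            N T_L T_R ε (με T_L T_R) ∧
          ∀ ν : MeasureTheory.Measure (Literature.MathematicalPhysics.KineticTheory.HeatConduction.PhaseSpace N),
            (Literature.MathematicalPhysics.KineticTheory.HeatConduction.pinnedChain ω₂ lam β γ).IsFlipSteadyState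
              N T_L T_R ε ν → ν = με T_L T_R) →
    ∀ D0 Dε : ℝ,
      Filter.Tendsto (fun δ : ℝ =>
          (Literature.MathematicalPhysics.KineticTheory.HeatConduction.pinnedChain ω₂ lam β γ).totalCurrent
            (μ0 (T + δ / 2) (T - δ / 2)) / δ) (nhdsWithin 0 {(0 : ℝ)}ᶜ) (nhds D0) →
      Filter.Tendsto (fun δ : ℝ =>
          (Literature.MathematicalPhysics.KineticTheory.HeatConduction.pinnedChain ω₂ lam β γ).totalCurrent
            (με (T + δ / 2) (T - δ / 2)) / δ) (nhdsWithin 0 {(0 : ℝ)}ᶜ) (nhds Dε) →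
      Dε ≤ D0) :
    Summit.AtomisticToContinuum.FouriersLaw.Theses.VanishingNoiseTransfer.NoiseLocality := by
  intro ω₂ lam β γ hω hl hβ hγ S hS T hT
  subst hS
  obtain ⟨μc, Dc, hfam, hcont, hpos, hcan⟩ := canonical_of_three hω hl hβ hγ hT
  -- the deterministic canonical family in `IsSteadyState` form
  have hfam0 : ∀ (N : ℕ) (T_L T_R : ℝ), 0 < T_L → 0 < T_R →
      (pinnedChain ω₂ lam β γ).IsSteadyState N T_L T_R (μc N 0 T_L T_R) ∧
        ∀ ν : Measure (PhaseSpace N),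
          (pinnedChain ω₂ lam β γ).IsSteadyState N T_L T_R ν → ν = μc N 0 T_L T_R := by
    intro N T_L T_R hL hR
    obtain ⟨h1, h2⟩ := hfam N 0 le_rfl zero_le_one T_L T_R hL hR
    refine ⟨((pinnedChain ω₂ lam β γ).isFlipSteadyState_zero_iff N T_L T_R _).1 h1, fun ν hν => h2 ν ?_⟩
    exact ((pinnedChain ω₂ lam β γ).isFlipSteadyState_zero_iff N T_L T_R ν).2 hν
  -- the transposed table
  set r : ℕ → ℝ → ℝ := fun N ε => (Dc N ε)⁻¹ with hr
  have hcont' : ∀ N : ℕ, 2 ≤ N → ContinuousOn (r N) (Set.Icc 0 1) :=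
    fun N hN => (hcont N).inv₀ fun ε hε => (hpos N hN ε hε.1 hε.2).ne'
  have hmono : ∀ N : ℕ, 2 ≤ N → ∀ ε : ℝ, 0 < ε → ε ≤ 1 → r (N + 1) ε ≤ r N ε := by
    intro N hN ε hε hε1
    have hle : Dc N ε ≤ Dc (N + 1) ε :=
      hM1 ω₂ lam β γ hω hl hβ hγ N hN ε hε hε1 T hT (μc N ε) (hfam N ε hε.le hε1)
        (μc (N + 1) ε) (hfam (N + 1) ε hε.le hε1) (Dc N ε) (Dc (N + 1) ε)
        (hcan N ε hε.le hε1 (μc N ε) (hfam N ε hε.le hε1))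
        (hcan (N + 1) ε hε.le hε1 (μc (N + 1) ε) (hfam (N + 1) ε hε.le hε1))
    simp only [hr]
    exact inv_anti₀ (hpos N hN ε hε.le hε1) hle
  have hnoise : ∀ N : ℕ, 2 ≤ N → ∀ ε : ℝ, 0 < ε → ε ≤ 1 → r N 0 ≤ r N ε := by
    intro N hN ε hε hε1
    have hle : Dc N ε ≤ Dc N 0 :=
      hM2 ω₂ lam β γ hω hl hβ hγ N hN ε hε hε1 T hT (μc N 0) (hfam0 N) (μc N ε) (hfam N ε hε.le hε1)
        (Dc N 0) (Dc N ε)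
        (hcan N 0 le_rfl zero_le_one (μc N 0) (hfam N 0 le_rfl zero_le_one))
        (hcan N ε hε.le hε1 (μc N ε) (hfam N ε hε.le hε1))
    simp only [hr]
    exact inv_anti₀ (hpos N hN ε hε.le hε1) hle
  have hpos' : ∀ N : ℕ, 2 ≤ N → 0 ≤ r N 0 := fun N hN => by
    simp only [hr]
    exact (inv_pos.2 (hpos N hN 0 le_rfl zero_le_one)).le
  obtain ⟨w, hw, hwb⟩ := modulus_of_monotone r hcont' hmono hnoise hpos'
  -- the crux for its own `μ0, με, D0, Dε`
  refine ⟨w, hw, ?_⟩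
  intro N ε hε hε1 μ0 με hμ0 hμε D0 Dε hD0 hDε
  by_cases hN : 2 ≤ N
  · have hμ0' : ∀ T_L T_R : ℝ, 0 < T_L → 0 < T_R →
        (pinnedChain ω₂ lam β γ).IsFlipSteadyState N T_L T_R 0 (μ0 T_L T_R) ∧
          ∀ ν : Measure (PhaseSpace N),
            (pinnedChain ω₂ lam β γ).IsFlipSteadyState N T_L T_R 0 ν → ν = μ0 T_L T_R := by
      intro T_L T_R hL hR
      refine ⟨((pinnedChain ω₂ lam β γ).isFlipSteadyState_zero_iff N T_L T_R _).2 (hμ0 T_L T_R hL hR).1,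
        fun ν hν => (hμ0 T_L T_R hL hR).2 ν ?_⟩
      exact ((pinnedChain ω₂ lam β γ).isFlipSteadyState_zero_iff N T_L T_R ν).1 hν
    have hD0eq : D0 = Dc N 0 := tendsto_nhds_unique hD0 (hcan N 0 le_rfl zero_le_one μ0 hμ0')
    have hDεeq : Dε = Dc N ε := tendsto_nhds_unique hDε (hcan N ε hε.le hε1 με hμε)
    have hD0pos : 0 < D0 := hD0eq ▸ hpos N hN 0 le_rfl zero_le_one
    have hDεpos : 0 < Dε := hDεeq ▸ hpos N hN ε hε.le hε1
    have hb : |Dε⁻¹ - D0⁻¹| ≤ w ε := by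
      rw [hD0eq, hDεeq]
      exact hwb N hN ε hε hε1
    have key : D0 - Dε = D0 * Dε * (Dε⁻¹ - D0⁻¹) := by
      rw [mul_sub, mul_assoc, mul_inv_cancel₀ hDεpos.ne', mul_one, mul_comm D0 Dε, mul_assoc,
        mul_inv_cancel₀ hD0pos.ne', mul_one]
    rw [key, abs_mul, abs_mul]
    calc |D0| * |Dε| * |Dε⁻¹ - D0⁻¹| ≤ |D0| * |Dε| * w ε := by gcongr
      _ = w ε * |D0| * |Dε| := by ring
  · -- `N ≤ 1`: no bond, no current, `D0 = Dε = 0`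
    have hN1 : N ≤ 1 := by omega
    have h0 : D0 = 0 :=
      Summit.AtomisticToContinuum.FouriersLaw.Theorems.NoiseLocality.FeketeReduction.response_eq_zero_of_le_one _ hN1 μ0 T D0 hD0
    have hε0 : Dε = 0 :=
      Summit.AtomisticToContinuum.FouriersLaw.Theorems.NoiseLocality.FeketeReduction.response_eq_zero_of_le_one _ hN1 με T Dε hDε
    simp [h0, hε0]


/-- Registered helper sub-goal `helper_noiseLocalityOfMonotone` of crux stmt-AtomisticToContinuum-11975 (line `fekete-transposed-uniformity`,
skeleton v6, lead c2): the two registered fixed-`N` sign stubs (M1) ∧ (M2), as hypotheses, give the crux — `noiseLocality_of_monotone` in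
registry form. CONDITIONAL. [folklore] -/
theorem helper_noiseLocalityOfMonotone : (∀ ω₂ lam β γ : ℝ, 0 < ω₂ → 0 < lam → 0 < β → 0 < γ → ∀ (N : ℕ), 2 ≤ N → ∀ ε : ℝ, 0 < ε → ε ≤ 1 → ∀ T : ℝ, 0 < T → ∀ μ : ℝ → ℝ → MeasureTheory.Measure (Literature.MathematicalPhysics.KineticTheory.HeatConduction.PhaseSpace N), (∀ T_L T_R : ℝ, 0 < T_L → 0 < T_R → (Literature.MathematicalPhysics.KineticTheory.HeatConduction.pinnedChain ω₂ lam β γ).IsFlipSteadyState N T_L T_R ε (μ T_L T_R) ∧ ∀ ν : MeasureTheory.Measure (Literature.MathematicalPhysics.KineticTheory.HeatConduction.PhaseSpace N), (Literature.MathematicalPhysics.KineticTheory.HeatConduction.pinnedChain ω₂ lam β γ).IsFlipSteadyState N T_L T_R ε ν → ν = μ T_L T_R) → ∀ μ' : ℝ → ℝ → MeasureTheory.Measure (Literature.MathematicalPhysics.KineticTheory.HeatConduction.PhaseSpace (N + 1)), (∀ T_L T_R : ℝ, 0 < T_L → 0 < T_R → (Literature.MathematicalPhysics.KineticTheory.HeatConduction.pinnedChain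 ω₂ lam β γ).IsFlipSteadyState (N + 1) T_L T_R ε (μ' T_L T_R) ∧ ∀ ν : MeasureTheory.Measure (Literature.MathematicalPhysics.KineticTheory.HeatConduction.PhaseSpace (N + 1)), (Literature.MathematicalPhysics.KineticTheory.HeatConduction.pinnedChain ω₂ lam β γ).IsFlipSteadyState (N + 1) T_L T_R ε ν → ν = μ' T_L T_R) → ∀ D D' : ℝ, Filter.Tendsto (fun δ : ℝ => (Literature.MathematicalPhysics.KineticTheory.HeatConduction.pinnedChain ω₂ lam β γ).totalCurrent (μ (T + δ / 2) (T - δ / 2)) / δ) (nhdsWithin 0 {(0 : ℝ)}ᶜ) (nhds D) → Filter.Tendsto (fun δ : ℝ => (Literature.MathematicalPhysics.KineticTheory.HeatConduction.pinnedChain ω₂ lam β γ).totalCurrent (μ' (T + δ / 2) (T - δ / 2)) / δ) (nhdsWithin 0 {(0 : ℝ)}ᶜ) (nhds D') → D ≤ D') → (∀ ω₂ lam β γ : ℝ, 0 < ω₂ → 0 < lam → 0 < β → 0 < γ → ∀ (N : ℕ), 2 ≤ N → ∀ ε : ℝ, 0 < ε → ε ≤ 1 → ∀ T : ℝ, 0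 < T → ∀ μ0 : ℝ → ℝ → MeasureTheory.Measure (Literature.MathematicalPhysics.KineticTheory.HeatConduction.PhaseSpace N), (∀ T_L T_R : ℝ, 0 < T_L → 0 < T_R → (Literature.MathematicalPhysics.KineticTheory.HeatConduction.pinnedChain ω₂ lam β γ).IsSteadyState N T_L T_R (μ0 T_L T_R) ∧ ∀ ν : MeasureTheory.Measure (Literature.MathematicalPhysics.KineticTheory.HeatConduction.PhaseSpace N), (Literature.MathematicalPhysics.KineticTheory.HeatConduction.pinnedChain ω₂ lam β γ).IsSteadyState N T_L T_R ν → ν = μ0 T_L T_R) → ∀ με : ℝ → ℝ → MeasureTheory.Measure (Literature.MathematicalPhysics.KineticTheory.HeatConduction.PhaseSpace N), (∀ T_L T_R : ℝ, 0 < T_L → 0 < T_R → (Literature.MathematicalPhysics.KineticTheory.HeatConduction.pinnedChain ω₂ lam β γ).IsFlipSteadyState N T_L T_R ε (με T_L T_R) ∧ ∀ ν : MeasureTheory.Measure (Literature.MathematicalPhysics.KineticTheory.HeatConduction.PhaseSpace N), (Literature.MathematicalPhysics.KineticTheory.HeatConduction.pinnedChain ω₂ lam β γ).IsFlipSteadyState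 N T_L T_R ε ν → ν = με T_L T_R) → ∀ D0 Dε : ℝ, Filter.Tendsto (fun δ : ℝ => (Literature.MathematicalPhysics.KineticTheory.HeatConduction.pinnedChain ω₂ lam β γ).totalCurrent (μ0 (T + δ / 2) (T - δ / 2)) / δ) (nhdsWithin 0 {(0 : ℝ)}ᶜ) (nhds D0) → Filter.Tendsto (fun δ : ℝ => (Literature.MathematicalPhysics.KineticTheory.HeatConduction.pinnedChain ω₂ lam β γ).totalCurrent (με (T + δ / 2) (T - δ / 2)) / δ) (nhdsWithin 0 {(0 : ℝ)}ᶜ) (nhds Dε) → Dε ≤ D0) → Summit.AtomisticToContinuum.FouriersLaw.Theses.VanishingNoiseTransfer.NoiseLocality :=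
  fun hM1 hM2 => noiseLocality_of_monotone hM1 hM2

end Summit.AtomisticToContinuum.FouriersLaw.Theorems.NoiseLocality.MonotoneReduction

end
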